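import Summits.QuantumFields.BalabanUV.T4Continuum.Support.NE3EnergyRateWSupRoutePiRInv
import Summits.QuantumFields.BalabanUV.T4Continuum.Support.NE7ConvOneStepWeightedUnique
import HarnessLib

/-!
# NE7RepWGaugeOfRoutePi — THE REP_w^gauge LETTER OF THE ONE-STEP END IS ROW NE3's ROUTE Π: its normal sizes `ν`, `κ₁` are THEOREMS of the
# exact curved right inverse `rightInvW` (leaf Π-R-W, `NE3RightInverseLetters`) and of the counting `preSizes_of_letters`; per pair only the
# R-ADAPTED RESIDUAL SLICE REPRESENTATIVE (`ResidualSliceRepT`, B11 Prop. 2 ∕ B8 Thm 2 TYPE), the WEIGHT with its LOCAL QUADRATIC LETTER, and k-free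
# currencies remain — the SAME per-pair binder `hleaves` as row NE3's local half (`NE3EnergyRateWSupRoutePiRInv`), read at the pair `(U♯, U′)`

Cell `pub-balaban`, rung (B)+1 sub-cell t4, lineage `b2b-balaban-t4-ne7-p1`, generation 69 (CRUX PROVER NE7 #1); hunt (h13) «THE SMOOTH LIFT IS IN
THE TREE», memo `t4/b2b-balaban-t4-ne7-p1-g69/HUNT-H13-ROUTE-PI-TRANSPOSED.md`.  File F30 (over F26 `NE7ConvOneStepWeightedUnique` and row NE3's
route-Π kernel: leaf-01-g8's `NE3SmoothRightInverseW.rightInvW` ∕ `NE3RightInverseLetters` (the EXACT right inverse of the linearised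
`(k+1)`-fold average at a curved small-field background with its letters (R1)–(R5), (R6′), k-FREE, N-FREE), owner g25's
`NE3LinearNormalPartPreSizes.preSizes_of_letters` and `NE3DecomposedRepOfLinearNormalPart.ResidualSliceRepT`).

WHY.  Memos H11 §2(iii) ∕ H12 §5(2) listed «the smooth exact right inverse of `levelQ′` at a curved background + its sizes `ν`, `κ₁`» as a
supplier brick NOT in the tree.  IT IS IN THE TREE, in row NE3's dictionary `D_W := dirIter L (k+1) W` (`TangentIter L k W Y ↔ D_W Y = 0`):
`rightInvW` (`D_W ∘ rightInvW = id` under the k-free binder `cruxC d L·ε < 1`) with the smooth-lift scalings `curlSq ≤ c₂M^{d−4}dirSq φ`,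
`Σ|curl| ≤ c₃M^{d−2}dirL1 φ`, `dirSq ≤ c₁M^{d−2}dirSq φ`, `dirL1 ≤ c₄M^{d−1}dirL1 φ` (`M = L^{k+1}`).  THIS FILE transposes row NE3's junction from
the pair `(U_A, U_B)` (background `cavg L U_B`) to the ONE-STEP pair `(U♯, U′)` (background `U♯` itself): in the lineage's SUM chart
`U′^u = U♯·e^{X}` no nonlinear normal part is needed — `X := X₀`, `X_N := rightInvW(D_{U♯}X₀)`, `X_T := X₀ − X_N ∈ T_♮(U♯)`.
WHAT ([folklore]; 0 def, 0 sorry).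
§1 `sub_mem_frameFreeBlockLandauW_symm` — the curved slice is symmetric: `Nn − X₀ ∈ T_♮(W) ⇒ X₀ − Nn ∈ T_♮(W)` (class data at `W`).
§2 **`repW_of_sliceRepT_preSizes`** — THE CONVERSION: `ResidualSliceRepT L N (k+1) U♯ U′ u X₀ Nn α₀` + the two PRE-SIZES of `Nn` against the
   tangent datum `‖Nn − X₀‖_w` (`ν₀ < 1`, `k₁`) + the strict line for `ν := ν₀∕(1−ν₀)`, `κ₁ := k₁∕(1−ν₀)²`, `α := α₀` ⟹ F26's `hrep` body VERBATIM
   (`gaugeAct u U′ = vary U♯ X 1`, `X = X_T + X_N`, `X_T ∈ frameFreeBlockLandauW`, the `ν`- and `κ₁`-letters against `‖X‖_w`, the line).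
§3 **`line_of_kfree_line`** — the per-level strict line from ONE k-free line through the currency `α₀·L^{k+1} ≤ α̂`:
   `(e^{α₀} − 1)²(L^{k+1})² ≤ α̂²e^{2α̂}`, `(ε(L^{k+1})^{−2} + 7α₀²)(L^{k+1})² ≤ ε + 7α̂²`.
§4 **`repW_of_routePi`** — THE PER-PAIR SUPPLIER: at level `k+1`, `U♯ ∈ sfClass d L N ε (k+1)`, given `(u, X₀, α₀, m, C)` with
   `ResidualSliceRepT L N (k+1) U♯ U′ u X₀ (rightInvW …(dirIter L (k+1) U♯ X₀)) α₀` [leaf Π-L1♮ at the pair], the weight `m ≥ 0` with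
   `(L^{k+1})^d Σ m² ≤ C²·dirSq X₀` and THE LOCAL QUADRATIC LETTER `‖dirIter L (k+1) U♯ X₀ (z,κ)‖ ≤ C₂((L^{k+1})·m(z,κ))²` [Π-C-3γ over (Π-REG-γ)],
   the currencies `α₀L^{k+1} ≤ α̂`, `mL^{k+1} ≤ α̂`, `C ≤ Ĉ`, the W6 regime `thetaLoc d L·ε < 1`, `ε ≤ 1`, and TWO k-free numeric lines
   (`hν̂ : ν̂ < 1` with `ν̂ := 2√(c₁+c₂)·C₂·Ĉ·α̂`, and the strict line for `ν̂∕(1−ν̂)`, `4c₃C₂Ĉ²ε∕(1−ν̂)²`, `α̂`) ⟹ F26's `hrep` body at `(U♯, U′)`.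
§5 **`hrep_of_hleaves`** — THE BINDER FORM over any data class `𝒟` and side conditions `P k D U♯`: F28 ∕ F29's `hrep` binder from `hleaves`.
HONEST FRAMING (page 1).  Bookkeeping over row NE3's landed kernel theorems; the residual slice representative (B11 Prop. 2 ∕ [Balaban1985RegularSpaces]
Thm 2 TYPE, ours in form), the weight with its quadratic letter ((Π-REG-γ) TYPE) and the numeric lines are HYPOTHESES, asserted for nothing; (APE)
untouched; NOT ONE-STEP, NOT NE7; spine 0∕9; finite T⁴ rung (B)+1 — NOT infinite volume, NOT mass gap, NOT Clay.  Continuum YM on T⁴ ⇐ BetaPertH ∧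
nine spine estimates (0/9 proved); BetaPertH ⇐ (D1) ∧ (D4) ∧ CAP+tail; G-an2-4 gates asym, D1 and NE2/3/4.
-/

set_option autoImplicit false

open scoped BigOperators Matrix Matrix.Norms.L2Operator
open NormedSpace Finset Set

namespace Summit.QuantumFields.BalabanUV.T4Continuum.NE7RepWGaugeOfRoutePi

open Literature.MathematicalPhysics.QuantumFieldTheory.Balaban1983to89
open B7Prop1Explicit B7Prop2Explicit
open T4AveragingDeficitWall (IsUnitaryCfg IsSkewDir SmallField vary curl curlSq dirSq dirL1)
open T4AveragingDeficitWallBoundary (IsPeriodicCfg periodBox)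
open AveragingDeficitPeriodicCounting (IsPeriodicDir)
open AveragingDeficitMultiLevelPrep (LevelSmall tower TangentIter)
open MinimalActionLevels (perWin)
open MinimalActionSandwich (admissible)
open MinimalActionRate (sfClass)
open NE3EnergyShapes (IsUnitarySite IsPeriodicSite)
open NE3EnergyWeightedShapes (energyNormW energyNormW_nonneg)
open NE3ProductPathBounds (energyNormW_neg energyNormW_sub_le)
open NE3CovariantCalculus (hsR hsR_sub_left)
open NE3TangentCovariantTower (dirIter framePotW tangentIter_iff_dirIter_eq_zero)
open NE3FrameFreeSliceW (frameFreeBlockLandauW cornerGaugeSpaceW)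
open BlockAveragePushDirGauge (gaugeDir)
open NE3ResidualSliceRep (dirIter_sub framePotW_sub)
open NE3DecomposedRepOfLinearNormalPart (ResidualSliceRepT)
open NE3LinearNormalPartPreSizes (preSizes_of_letters)
open NE3LocalCrudeWPair (exp_sub_one_le_mul_exp)
open NE3EnergyRateWSupRoutePiRInv (dirIter_skew isPeriodicDir_dirIter forall_norm_le_of_periodBox)
open NE3DecomposedRepSfClass (levelRadius_rescale)
open NE3QbarIterCovLiftPrep (cruxC)
open NE3SmoothRightInverseW (rightInvW)
open NE3RightInverseSolveLetters (thetaLoc cruxC_nonneg cruxC_le_thetaLoc)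
open NE3RightInverseL2Letter (l2C l2C_nonneg)
open NE3RightInverseL1Letter (l1C l1C_nonneg)
open NE3HatInvCurlLetters (curl2C curl1C curl2C_nonneg curl1C_nonneg)
open NE3RightInverseLetters (rightInvW_periodic rightInvW_R1 curlSq_rightInvW_le sum_norm_curl_rightInvW_le rightInvW_R4)

noncomputable section

variable {d : ℕ} {n : Type*} [Fintype n] [DecidableEq n]

/-! ## §1 The curved slice is symmetric -/

/-- **THE CURVED FRAME-FREE SLICE IS CLOSED UNDER `Y ↦ −Y`** (written for differences, multi-level small-field class at `W`):
`Nn − X₀ ∈ T_♮(W) ⇒ X₀ − Nn ∈ T_♮(W)` — every clause of `frameFreeBlockLandauW` is linear. [folklore] -/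
theorem sub_mem_frameFreeBlockLandauW_symm [Nonempty n] {L N : ℕ} (hL : 1 ≤ L) (k : ℕ) {W : Site d → Fin d → (Matrix n n ℂ)ˣ} {x : ℝ}
    (hWu : IsUnitaryCfg W) (hx : 0 ≤ x) (hs : LevelSmall d L k x) (hWx : SmallField W x)
    {X₀ Nn : Site d → Fin d → Matrix n n ℂ} (h : (fun y μ => Nn y μ - X₀ y μ) ∈ frameFreeBlockLandauW (d := d) (n := n) L N (k + 1) W) :
    (fun y μ => X₀ y μ - Nn y μ) ∈ frameFreeBlockLandauW (d := d) (n := n) L N (k + 1) W := by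
  obtain ⟨hsk, hper, htan, hfr, horth⟩ := h
  refine ⟨fun y μ => ?_, fun y κ μ => ?_, ?_, fun z => ?_, fun μ hμ => ?_⟩
  · show X₀ y μ - Nn y μ ∈ skewAdjoint (Matrix n n ℂ)
    rw [← neg_sub]
    exact (skewAdjoint (Matrix n n ℂ)).neg_mem (hsk y μ)
  · show X₀ (y + ((tower L N (k + 1) : ℕ) : ℤ) • e κ) μ - Nn (y + ((tower L N (k + 1) : ℕ) : ℤ) • e κ) μ = X₀ y μ - Nn y μ
    have e1 : Nn (y + ((tower L N (k + 1) : ℕ) : ℤ) • e κ) μ - X₀ (y + ((tower L N (k + 1) : ℕ) : ℤ) • e κ) μ = Nn y μ - X₀ y μ :=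
      hper y κ μ
    rw [← neg_sub, e1, neg_sub]
  · show TangentIter L (k + 1 - 1) W fun y μ => X₀ y μ - Nn y μ
    have htan' : TangentIter L (k + 1 - 1) W fun y μ => Nn y μ - X₀ y μ := htan
    rw [Nat.add_sub_cancel] at htan' ⊢
    rw [tangentIter_iff_dirIter_eq_zero, dirIter_sub hL k hWu hx hs hWx] at htan' ⊢
    funext z κ
    have e := congrFun (congrFun htan' z) κ
    simp only [Pi.zero_apply] at e ⊢
    rw [sub_eq_zero] at e ⊢
    exact e.symm
  · have hz := hfr z
    rw [framePotW_sub hL k hWu hx hs hWx] at hz ⊢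
    rw [sub_eq_zero] at hz ⊢
    exact hz.symm
  · have h0 := horth μ hμ
    simp_rw [hsR_sub_left, Finset.sum_sub_distrib] at h0 ⊢
    rw [sub_eq_zero] at h0 ⊢
    exact h0.symm

/-! ## §2 The conversion: F26's `hrep` body from the adapted slice representative and the pre-sizes -/
/-- **THE CONVERSION — F26's `hrep` body FROM `ResidualSliceRepT` AT `(U♯, U′)` AND THE PRE-SIZES OF THE LINEAR NORMAL PART** against the
tangent datum `‖Nn − X₀‖_w` (`ν₀ < 1`, `k₁`): `X := X₀`, `X_N := Nn`, `X_T := X₀ − Nn`, `ν := ν₀∕(1−ν₀)`, `κ₁ := k₁∕(1−ν₀)²`. [folklore] -/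
theorem repW_of_sliceRepT_preSizes [Nonempty n] {L N : ℕ} (hL : 1 ≤ L) (k : ℕ) {Us U' : Site d → Fin d → (Matrix n n ℂ)ˣ} {x : ℝ}
    (hWu : IsUnitaryCfg Us) (hx : 0 ≤ x) (hs : LevelSmall d L k x) (hWx : SmallField Us x)
    {u : Site d → (Matrix n n ℂ)ˣ} {X₀ Nn : Site d → Fin d → Matrix n n ℂ} {α₀ : ℝ}
    (h : ResidualSliceRepT L N (k + 1) Us U' u X₀ Nn α₀) {ν₀ k₁ a CP R : ℝ} (hν₀ : 0 ≤ ν₀) (hν₀1 : ν₀ < 1) (hk₁ : 0 ≤ k₁)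
    (hN1 : energyNormW L (k + 1) Us Nn (periodBox (d := d) (N * L ^ (k + 1)))
      ≤ ν₀ * energyNormW L (k + 1) Us (fun y μ => Nn y μ - X₀ y μ) (periodBox (d := d) (N * L ^ (k + 1))))
    (hN2 : a * ∑ p ∈ perWin d (N * L ^ (k + 1)), ‖curl Us Nn p‖
      ≤ k₁ * energyNormW L (k + 1) Us (fun y μ => Nn y μ - X₀ y μ) (periodBox (d := d) (N * L ^ (k + 1))) ^ 2)
    (hline : 2 * (k₁ / (1 - ν₀) ^ 2) < ((((1 / 2 - (ν₀ / (1 - ν₀)) ^ 2) / (2 * (1 + CP)) - (ν₀ / (1 - ν₀)) ^ 2) / 2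
        - 576 * d * (Real.exp α₀ - 1) ^ 2 * ((L : ℝ) ^ (k + 1)) ^ 2) / (Fintype.card n : ℝ)
        - 28 * d * (R + 7 * α₀ ^ 2) * ((L : ℝ) ^ (k + 1)) ^ 2)) :
    ∃ (u : Site d → (Matrix n n ℂ)ˣ) (X XT XN : Site d → Fin d → Matrix n n ℂ) (α ν κ₁ : ℝ),
      IsUnitarySite u ∧ IsSkewDir X ∧ IsPeriodicDir X ((N * L ^ (k + 1) : ℕ) : ℤ) ∧ 0 ≤ α ∧ (∀ x μ, ‖X x μ‖ ≤ α) ∧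
      gaugeAct u U' = vary Us X 1 ∧
      X = XT + XN ∧ XT ∈ frameFreeBlockLandauW (d := d) (n := n) L N (k + 1) Us ∧ IsSkewDir XN ∧ 0 ≤ ν ∧
      energyNormW L (k + 1) Us XN (periodBox (d := d) (N * L ^ (k + 1)))
        ≤ ν * energyNormW L (k + 1) Us X (periodBox (d := d) (N * L ^ (k + 1))) ∧
      a * (∑ p ∈ perWin d (N * L ^ (k + 1)), ‖curl Us XN p‖)
        ≤ κ₁ * energyNormW L (k + 1) Us X (periodBox (d := d) (N * L ^ (k + 1))) ^ 2 ∧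
      2 * κ₁ < ((((1 / 2 - ν ^ 2) / (2 * (1 + CP)) - ν ^ 2) / 2
          - 576 * d * (Real.exp α - 1) ^ 2 * ((L : ℝ) ^ (k + 1)) ^ 2) / (Fintype.card n : ℝ)
          - 28 * d * (R + 7 * α ^ 2) * ((L : ℝ) ^ (k + 1)) ^ 2) := by
  set F := periodBox (d := d) (N * L ^ (k + 1)) with hF
  -- the slice part `X_T := X₀ − Nn`
  have hT : (fun y μ => X₀ y μ - Nn y μ) ∈ frameFreeBlockLandauW (d := d) (n := n) L N (k + 1) Us :=
    sub_mem_frameFreeBlockLandauW_symm hL k hWu hx hs hWx h.tangent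
  have hTsk : IsSkewDir (fun y μ => Nn y μ - X₀ y μ) := h.tangent.1
  have hNsk : IsSkewDir Nn := fun y μ => by
    have e : Nn y μ = (Nn y μ - X₀ y μ) + X₀ y μ := (sub_add_cancel _ _).symm
    rw [e]; exact (skewAdjoint (Matrix n n ℂ)).add_mem (hTsk y μ) (h.skew y μ)
  -- energies
  set EX : ℝ := energyNormW L (k + 1) Us X₀ F with hEX
  set EN : ℝ := energyNormW L (k + 1) Us Nn F with hEN
  set ET : ℝ := energyNormW L (k + 1) Us (fun y μ => Nn y μ - X₀ y μ) F with hET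
  have hEX0 : 0 ≤ EX := energyNormW_nonneg _ _ _ _ _
  have hEN0 : 0 ≤ EN := energyNormW_nonneg _ _ _ _ _
  have hET0 : 0 ≤ ET := energyNormW_nonneg _ _ _ _ _
  have h1ν : 0 < 1 - ν₀ := by linarith
  -- `ET = ‖Nn − X₀‖_w ≤ ‖Nn‖_w + ‖X₀‖_w ≤ ν₀·ET + EX`
  have hET1 : ET ≤ EN + EX := by
    have e : (fun y μ => Nn y μ - X₀ y μ) = Nn - X₀ := by funext y μ; rfl
    rw [hET, e]; exact energyNormW_sub_le L (k + 1) Us Nn X₀ F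
  have hET2 : (1 - ν₀) * ET ≤ EX := by nlinarith [hN1]
  have hET3 : ET ≤ EX / (1 - ν₀) := by rw [le_div_iff₀ h1ν]; linarith
  have hνle : EN ≤ ν₀ / (1 - ν₀) * EX := by
    calc EN ≤ ν₀ * ET := hN1
      _ ≤ ν₀ * (EX / (1 - ν₀)) := mul_le_mul_of_nonneg_left hET3 hν₀
      _ = ν₀ / (1 - ν₀) * EX := by ring
  have hκle : a * ∑ p ∈ perWin d (N * L ^ (k + 1)), ‖curl Us Nn p‖ ≤ k₁ / (1 - ν₀) ^ 2 * EX ^ 2 := by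
    have h2 : ET ^ 2 ≤ (EX / (1 - ν₀)) ^ 2 := pow_le_pow_left₀ hET0 hET3 2
    calc a * ∑ p ∈ perWin d (N * L ^ (k + 1)), ‖curl Us Nn p‖ ≤ k₁ * ET ^ 2 := hN2
      _ ≤ k₁ * (EX / (1 - ν₀)) ^ 2 := mul_le_mul_of_nonneg_left h2 hk₁
      _ = k₁ / (1 - ν₀) ^ 2 * EX ^ 2 := by field_simp
  refine ⟨u, X₀, fun y μ => X₀ y μ - Nn y μ, Nn, α₀, ν₀ / (1 - ν₀), k₁ / (1 - ν₀) ^ 2, h.gauge.1, h.skew, h.per, h.hα₀, h.sup, h.rep,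
    ?_, hT, hNsk, by positivity, hνle, hκle, hline⟩
  funext y μ
  simp only [Pi.add_apply, sub_add_cancel]

/-! ## §3 The per-level strict line from one k-free line -/
/-- **THE CURRENCY STEP FOR THE HESSIAN-LIPSCHITZ TERM**: `α₀·M ≤ α̂`, `1 ≤ M` ⟹ `(e^{α₀} − 1)²·M² ≤ α̂²·e^{2α̂}`. [folklore] -/
theorem exp_term_le_of_currency {α₀ αh M : ℝ} (hα₀ : 0 ≤ α₀) (hM : 1 ≤ M) (hcur : α₀ * M ≤ αh) :
    (Real.exp α₀ - 1) ^ 2 * M ^ 2 ≤ αh ^ 2 * Real.exp (2 * αh) := by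
  have hM0 : 0 < M := by linarith
  have hαh : α₀ ≤ αh := by nlinarith
  have h1 : Real.exp α₀ - 1 ≤ α₀ * Real.exp α₀ := exp_sub_one_le_mul_exp α₀
  have h0 : 0 ≤ Real.exp α₀ - 1 := by have := Real.add_one_le_exp α₀; linarith
  have h2 : Real.exp α₀ ≤ Real.exp αh := Real.exp_le_exp.mpr hαh
  have h3 : (Real.exp α₀ - 1) * M ≤ αh * Real.exp αh := by
    calc (Real.exp α₀ - 1) * M ≤ α₀ * Real.exp α₀ * M := mul_le_mul_of_nonneg_right h1 hM0.le
      _ = (α₀ * M) * Real.exp α₀ := by ring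
      _ ≤ αh * Real.exp αh := mul_le_mul hcur h2 (Real.exp_pos _).le (by nlinarith)
  have h4 : 0 ≤ (Real.exp α₀ - 1) * M := mul_nonneg h0 hM0.le
  have h5 := pow_le_pow_left₀ h4 h3 2
  have e : (αh * Real.exp αh) ^ 2 = αh ^ 2 * Real.exp (2 * αh) := by
    rw [mul_pow, ← Real.exp_nat_mul]; norm_num
  calc (Real.exp α₀ - 1) ^ 2 * M ^ 2 = ((Real.exp α₀ - 1) * M) ^ 2 := by ring
    _ ≤ (αh * Real.exp αh) ^ 2 := h5
    _ = αh ^ 2 * Real.exp (2 * αh) := e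

omit [DecidableEq n] in
/-- **THE PER-LEVEL STRICT LINE FROM ONE k-FREE LINE** (`M = L^{k+1} ≥ 1`, `α₀M ≤ α̂`, `0 < card n`): the k-free line with the
currency-majorised terms `576d·α̂²e^{2α̂}` and `28d(ε + 7α̂²)` implies F26's per-level line with `α = α₀`, `R = ε∕M²`. [folklore] -/
theorem line_of_kfree_line {L : ℕ} (hL : 1 ≤ L) (k : ℕ) {α₀ αh ε ν κ₁ CP : ℝ} (hα₀ : 0 ≤ α₀) (hcur : α₀ * (L : ℝ) ^ (k + 1) ≤ αh)
    (hcard : 0 < (Fintype.card n : ℝ))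
    (hline : 2 * κ₁ < ((((1 / 2 - ν ^ 2) / (2 * (1 + CP)) - ν ^ 2) / 2 - 576 * d * (αh ^ 2 * Real.exp (2 * αh))) / (Fintype.card n : ℝ)
        - 28 * d * (ε + 7 * αh ^ 2))) :
    2 * κ₁ < ((((1 / 2 - ν ^ 2) / (2 * (1 + CP)) - ν ^ 2) / 2
        - 576 * d * (Real.exp α₀ - 1) ^ 2 * ((L : ℝ) ^ (k + 1)) ^ 2) / (Fintype.card n : ℝ)
        - 28 * d * (ε / ((L : ℝ) ^ (k + 1)) ^ 2 + 7 * α₀ ^ 2) * ((L : ℝ) ^ (k + 1)) ^ 2) := by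
  set M : ℝ := (L : ℝ) ^ (k + 1) with hM
  have hM1 : 1 ≤ M := one_le_pow₀ (by exact_mod_cast hL)
  have hM0 : 0 < M := by linarith
  have h1 : (Real.exp α₀ - 1) ^ 2 * M ^ 2 ≤ αh ^ 2 * Real.exp (2 * αh) := exp_term_le_of_currency hα₀ hM1 hcur
  have h2 : (ε / M ^ 2 + 7 * α₀ ^ 2) * M ^ 2 ≤ ε + 7 * αh ^ 2 := by
    have e : (ε / M ^ 2 + 7 * α₀ ^ 2) * M ^ 2 = ε + 7 * (α₀ * M) ^ 2 := by field_simp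
    rw [e]
    have : (α₀ * M) ^ 2 ≤ αh ^ 2 := pow_le_pow_left₀ (by positivity) hcur 2
    linarith
  have hd : (0 : ℝ) ≤ d := Nat.cast_nonneg d
  have h3 : 576 * d * (Real.exp α₀ - 1) ^ 2 * M ^ 2 ≤ 576 * d * (αh ^ 2 * Real.exp (2 * αh)) := by nlinarith
  have h4 : 28 * d * (ε / M ^ 2 + 7 * α₀ ^ 2) * M ^ 2 ≤ 28 * d * (ε + 7 * αh ^ 2) := by nlinarith
  have h5 : (((1 / 2 - ν ^ 2) / (2 * (1 + CP)) - ν ^ 2) / 2 - 576 * d * (αh ^ 2 * Real.exp (2 * αh))) / (Fintype.card n : ℝ)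
      ≤ (((1 / 2 - ν ^ 2) / (2 * (1 + CP)) - ν ^ 2) / 2 - 576 * d * (Real.exp α₀ - 1) ^ 2 * M ^ 2) / (Fintype.card n : ℝ) :=
    div_le_div_of_nonneg_right (by linarith) hcard.le
  linarith

/-! ## §4 The per-pair supplier: F26's `hrep` body from row NE3's route Π at the pair `(U♯, U′)` -/
/-- **REP_w^gauge AT THE PAIR `(U♯, U′)` FROM ROW NE3's ROUTE Π** (level `k+1`, `M = L^{k+1}`, `U♯ ∈ sfClass d L N ε (k+1)`,
`LevelSmall d L k (ε∕M²)`, W6 regime `thetaLoc d L·ε < 1`, `ε ≤ 1`).  PER PAIR — row NE3's `hleaves` read at `(W, U_A) := (U♯, U′)`: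
`ResidualSliceRepT L N (k+1) U♯ U′ u X₀ (rightInvW …(dirIter L (k+1) U♯ X₀)) α₀` (for all proof arguments of `rightInvW`), the weight `m ≥ 0`
with `M^d·Σ_{periodBox N} m² ≤ C²·dirSq X₀`, the LOCAL QUADRATIC LETTER `‖dirIter L (k+1) U♯ X₀ (z,κ)‖ ≤ C₂(M·m(z,κ))²`, the currencies
`α₀M ≤ α̂`, `mM ≤ α̂`, `C ≤ Ĉ`.  UNIFORM: `α̂ ≤ 1`, `ν̂ < 1`, ONE k-free strict line.  CONCLUSION: F26's `hrep` body with `X := X₀`,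
`X_N := rightInvW …(D_{U♯}X₀)`, `X_T := X₀ − X_N`, `α := α₀`, `ν := ν̂∕(1−ν̂)`, `κ₁ := 4c₃C₂Ĉ²ε∕(1−ν̂)²` — the normal sizes are THEOREMS. [folklore] -/
theorem repW_of_routePi [Nonempty n] {L N : ℕ} [NeZero L] [NeZero N] (hL : 2 ≤ L) (k : ℕ) {ε : ℝ} (hε : 0 < ε)
    (hls : LevelSmall d L k (ε / ((L : ℝ) ^ (k + 1)) ^ 2)) (hθl : thetaLoc d L * ε < 1) (hε1 : ε ≤ 1)
    {C₂ αh Ch CP : ℝ} (hC₂ : 0 ≤ C₂) (hαh0 : 0 ≤ αh) (hαh1 : αh ≤ 1) (hCh0 : 0 ≤ Ch)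
    {νh κh : ℝ} (hνh : νh = 2 * Real.sqrt (l2C d L / (1 - thetaLoc d L * ε) ^ 2 + curl2C d L / (1 - thetaLoc d L * ε) ^ 2) * C₂ * Ch * αh)
    (hκh : κh = 4 * (curl1C d L / (1 - thetaLoc d L * ε)) * C₂ * Ch ^ 2 * ε) (hν : νh < 1)
    (hline : 2 * (κh / (1 - νh) ^ 2) < ((((1 / 2 - (νh / (1 - νh)) ^ 2) / (2 * (1 + CP)) - (νh / (1 - νh)) ^ 2) / 2
        - 576 * d * (αh ^ 2 * Real.exp (2 * αh))) / (Fintype.card n : ℝ) - 28 * d * (ε + 7 * αh ^ 2)))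
    {Us U' : Site d → Fin d → (Matrix n n ℂ)ˣ} (hUs : Us ∈ sfClass d L N ε (k + 1))
    {u : Site d → (Matrix n n ℂ)ˣ} {X₀ : Site d → Fin d → Matrix n n ℂ} {α₀ : ℝ} {m : Site d → Fin d → ℝ} {C : ℝ}
    (hXs : IsSkewDir X₀)
    (hrep : ∀ (hWu : IsUnitaryCfg Us) (hx : 0 ≤ ε / ((L : ℝ) ^ (k + 1)) ^ 2) (hs : LevelSmall d L k (ε / ((L : ℝ) ^ (k + 1)) ^ 2))
        (hWx : SmallField Us (ε / ((L : ℝ) ^ (k + 1)) ^ 2))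
        (hθ : cruxC d L * (((L : ℝ) ^ (k + 1)) ^ 2 * (ε / ((L : ℝ) ^ (k + 1)) ^ 2)) < 1)
        (hφ : IsSkewDir (dirIter L (k + 1) Us X₀)),
      ResidualSliceRepT L N (k + 1) Us U' u X₀ (rightInvW hL k hWu hx hs hWx N hθ hφ) α₀)
    (hm0 : ∀ z κ, 0 ≤ m z κ) (hC : 0 ≤ C)
    (hsq : ((L : ℝ) ^ (k + 1)) ^ d * ∑ z ∈ periodBox (d := d) N, ∑ κ : Fin d, m z κ ^ 2
      ≤ C ^ 2 * dirSq X₀ (periodBox (d := d) (N * L ^ (k + 1))))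
    (hφq : ∀ z ∈ periodBox (d := d) N, ∀ κ : Fin d, ‖dirIter L (k + 1) Us X₀ z κ‖ ≤ C₂ * ((L : ℝ) ^ (k + 1) * m z κ) ^ 2)
    (hαh : α₀ * (L : ℝ) ^ (k + 1) ≤ αh) (hmh : ∀ z κ, m z κ * (L : ℝ) ^ (k + 1) ≤ αh) (hCh : C ≤ Ch) :
    ∃ (u : Site d → (Matrix n n ℂ)ˣ) (X XT XN : Site d → Fin d → Matrix n n ℂ) (α ν κ₁ : ℝ),
      IsUnitarySite u ∧ IsSkewDir X ∧ IsPeriodicDir X ((N * L ^ (k + 1) : ℕ) : ℤ) ∧ 0 ≤ α ∧ (∀ x μ, ‖X x μ‖ ≤ α) ∧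
      gaugeAct u U' = vary Us X 1 ∧
      X = XT + XN ∧ XT ∈ frameFreeBlockLandauW (d := d) (n := n) L N (k + 1) Us ∧ IsSkewDir XN ∧ 0 ≤ ν ∧
      energyNormW L (k + 1) Us XN (periodBox (d := d) (N * L ^ (k + 1)))
        ≤ ν * energyNormW L (k + 1) Us X (periodBox (d := d) (N * L ^ (k + 1))) ∧
      ε / ((L : ℝ) ^ (k + 1)) ^ 2 * (∑ p ∈ perWin d (N * L ^ (k + 1)), ‖curl Us XN p‖)
        ≤ κ₁ * energyNormW L (k + 1) Us X (periodBox (d := d) (N * L ^ (k + 1))) ^ 2 ∧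
      2 * κ₁ < ((((1 / 2 - ν ^ 2) / (2 * (1 + CP)) - ν ^ 2) / 2
          - 576 * d * (Real.exp α - 1) ^ 2 * ((L : ℝ) ^ (k + 1)) ^ 2) / (Fintype.card n : ℝ)
          - 28 * d * (ε / ((L : ℝ) ^ (k + 1)) ^ 2 + 7 * α ^ 2) * ((L : ℝ) ^ (k + 1)) ^ 2) := by
  have hL1 : 1 ≤ L := by omega
  have hL1r : (1 : ℝ) ≤ L := by exact_mod_cast hL1
  -- the W6 regime numerics and the route-Π constants
  have hθc : cruxC d L * ε < 1 := lt_of_le_of_lt (mul_le_mul_of_nonneg_right (cruxC_le_thetaLoc d L) hε.le) hθl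
  have h1θl : 0 < 1 - thetaLoc d L * ε := by linarith
  set c₁ : ℝ := l2C d L / (1 - thetaLoc d L * ε) ^ 2 with hc₁def
  set c₂ : ℝ := curl2C d L / (1 - thetaLoc d L * ε) ^ 2 with hc₂def
  set c₃ : ℝ := curl1C d L / (1 - thetaLoc d L * ε) with hc₃def
  set c₄ : ℝ := l1C d L / (1 - thetaLoc d L * ε) with hc₄def
  have hc₁ : 0 ≤ c₁ := by have := l2C_nonneg d L; positivity
  have hc₂ : 0 ≤ c₂ := by have := curl2C_nonneg d L; positivity
  have hc₃ : 0 ≤ c₃ := by have := curl1C_nonneg d L; positivity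
  have hc₄ : 0 ≤ c₄ := by have := l1C_nonneg d L; positivity
  -- the class data of the background `U♯` and the radius identities
  obtain ⟨hWu, hWP, hWx⟩ := hUs
  have hT : ((tower L N (k + 1) : ℕ) : ℤ) = ((N * L ^ (k + 1) : ℕ) : ℤ) := by
    rw [NE3FramePotBoundW.tower_eq_pow_mul, Nat.mul_comm]
  have hWPt : IsPeriodicCfg Us ((tower L N (k + 1) : ℕ) : ℤ) := by rw [hT]; exact hWP
  have hx : 0 ≤ ε / ((L : ℝ) ^ (k + 1)) ^ 2 := by positivity
  have hxM : ((L : ℝ) ^ (k + 1)) ^ 2 * (ε / ((L : ℝ) ^ (k + 1)) ^ 2) = ε := (levelRadius_rescale hL1 ε k).2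
  set M : ℝ := (L : ℝ) ^ (k + 1) with hMdef
  have hM0 : 0 < M := by positivity
  have hM1 : 1 ≤ M := one_le_pow₀ hL1r
  have hθ : cruxC d L * (M ^ 2 * (ε / M ^ 2)) < 1 := by rw [hxM]; exact hθc
  have hθlM : thetaLoc d L * (M ^ 2 * (ε / M ^ 2)) < 1 := by rw [hxM]; exact hθl
  have hεM : M ^ 2 * (ε / M ^ 2) ≤ 1 := by rw [hxM]; exact hε1
  -- the coarse datum `φ := dirIter L (k+1) U♯ X₀`: skew, `N`-periodic
  have hφs : IsSkewDir (dirIter L (k + 1) Us X₀) := dirIter_skew hL1 k hWu hx hls hWx hXs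
  have h := hrep hWu hx hls hWx hθ hφs
  have hXP : IsPeriodicDir X₀ ((tower L N (k + 1) : ℕ) : ℤ) := by rw [hT]; exact h.per
  have hφP : IsPeriodicDir (dirIter L (k + 1) Us X₀) (N : ℤ) := isPeriodicDir_dirIter L N (k + 1) hWPt hXP
  -- the letters (R1)–(R4) of `Nn := rightInvW … φ`, radius identities rewritten to `ε`
  have hR1 := rightInvW_R1 hL k hWu hWPt hx hls hWx hθ hθlM hεM hφs
  have hR2 := curlSq_rightInvW_le hL k hWu hWPt hx hls hWx hθ hθlM hεM hφs
  have hR3 := sum_norm_curl_rightInvW_le hL k hWu hWPt hx hls hWx hθ hθlM hεM hφs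
  have hR4 := rightInvW_R4 hL k hWu hWPt hx hls hWx hθ hθlM hεM hφs
  rw [hxM] at hR1 hR2 hR3 hR4
  -- the pre-sizes (owner g25's counting) with the ceiling `α̂∕M` of the weight and the constant `Ĉ`
  have hsq' : M ^ d * ∑ z ∈ periodBox (d := d) N, ∑ κ : Fin d, m z κ ^ 2 ≤ Ch ^ 2 * dirSq X₀ (periodBox (d := d) (N * L ^ (k + 1))) := by
    refine hsq.trans (mul_le_mul_of_nonneg_right (pow_le_pow_left₀ hC hCh 2) ?_)
    unfold dirSq; positivity
  have hmα : ∀ z κ, m z κ ≤ αh / M := fun z κ => by rw [le_div_iff₀ hM0]; exact hmh z κ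
  have hαM0 : 0 ≤ αh / M := by positivity
  have hρ : 2 * (c₁ + c₂) * C₂ ^ 2 * Ch ^ 2 * (αh / M * M) ^ 2 ≤ 1 / 2 := by
    have e : αh / M * M = αh := by field_simp
    rw [e]
    have hν0 : 0 ≤ νh := by rw [hνh]; positivity
    have hν2 : (νh) ^ 2 < 1 := by nlinarith
    have hsq2 : Real.sqrt (c₁ + c₂) ^ 2 = c₁ + c₂ := Real.sq_sqrt (add_nonneg hc₁ hc₂)
    have e2 : (νh) ^ 2 = 4 * (c₁ + c₂) * C₂ ^ 2 * Ch ^ 2 * αh ^ 2 := by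
      rw [show νh = 2 * Real.sqrt (c₁ + c₂) * C₂ * Ch * αh from hνh]
      rw [show (2 * Real.sqrt (c₁ + c₂) * C₂ * Ch * αh) ^ 2 = 4 * Real.sqrt (c₁ + c₂) ^ 2 * C₂ ^ 2 * Ch ^ 2 * αh ^ 2 by ring, hsq2]
    rw [e2] at hν2
    linarith
  have hJ1 : (αh / M + 0) * M ≤ 1 := by
    have e : (αh / M + 0) * M = αh := by rw [add_zero]; field_simp
    rw [e]; exact hαh1
  have ha : 0 ≤ ε / M ^ 2 := by positivity
  obtain ⟨hN1, hN2, -⟩ := preSizes_of_letters (N := N) hL1 (k + 1) Us (X₀ := X₀) (Nn := rightInvW hL k hWu hx hls hWx N hθ hφs)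
    (φ := dirIter L (k + 1) Us X₀) (m := m) (αN := 0) (a := ε / M ^ 2) hαM0 le_rfl hC₂ hCh0 hc₁ hc₂ hc₃ hc₄ ha hm0 hmα hsq' hφq
    hR1 hR2 hR3 hR4 hρ hJ1
  -- the two pre-sizes in the currency `ν̂`, `4c₃C₂Ĉ²ε`
  have eν : 2 * Real.sqrt (c₁ + c₂) * C₂ * Ch * (αh / M * M) = νh := by
    have e : αh / M * M = αh := by field_simp
    rw [e, hνh]
  have ek : 4 * c₃ * C₂ * Ch ^ 2 * (ε / M ^ 2 * M ^ 2) = κh := by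
    have e : ε / M ^ 2 * M ^ 2 = ε := by field_simp
    rw [e, hκh]
  rw [eν] at hN1
  rw [ek] at hN2
  -- the per-level strict line from the k-free one, then the conversion of §2
  have hν0 : 0 ≤ νh := by rw [hνh]; positivity
  have hk0 : 0 ≤ κh := by rw [hκh]; positivity
  have hcard : 0 < (Fintype.card n : ℝ) := by exact_mod_cast Fintype.card_pos
  have hlineK := line_of_kfree_line (n := n) (d := d) hL1 k h.hα₀ hαh hcard
    (ν := νh / (1 - νh)) (κ₁ := κh / (1 - νh) ^ 2) (CP := CP) hline
  exact repW_of_sliceRepT_preSizes hL1 k hWu hx hls hWx h hν0 hν hk0 hN1 hN2 (CP := CP) (R := ε / M ^ 2) hlineK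

/-! ## §5 The binder form: F28 ∕ F29's `hrep` from the per-pair binder `hleaves` -/
/-- **THE `hrep` BINDER OF THE ONE-STEP END FROM ROW NE3's PER-PAIR BINDER `hleaves`** over any data class `𝒟` and any side conditions
`P k D U♯` on the small critical configuration (not used by the supplier): uniform hypotheses as in `repW_of_routePi` (with F28's family
`hls`); per pair `(U♯, U′)` at a datum of `𝒟` the adapted residual slice representative, the weight, the quadratic letter, the currencies. [folklore] -/
theorem hrep_of_hleaves [Nonempty n] {L N : ℕ} [NeZero L] [NeZero N] (hL : 2 ≤ L) {ε : ℝ} (hε : 0 < ε)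
    (hls : ∀ k : ℕ, LevelSmall d L k (ε / ((L : ℝ) ^ (k + 1)) ^ 2)) (hθl : thetaLoc d L * ε < 1) (hε1 : ε ≤ 1)
    {C₂ αh Ch CP : ℝ} (hC₂ : 0 ≤ C₂) (hαh0 : 0 ≤ αh) (hαh1 : αh ≤ 1) (hCh0 : 0 ≤ Ch)
    {νh κh : ℝ} (hνh : νh = 2 * Real.sqrt (l2C d L / (1 - thetaLoc d L * ε) ^ 2 + curl2C d L / (1 - thetaLoc d L * ε) ^ 2) * C₂ * Ch * αh)
    (hκh : κh = 4 * (curl1C d L / (1 - thetaLoc d L * ε)) * C₂ * Ch ^ 2 * ε) (hν : νh < 1)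
    (hline : 2 * (κh / (1 - νh) ^ 2) < ((((1 / 2 - (νh / (1 - νh)) ^ 2) / (2 * (1 + CP)) - (νh / (1 - νh)) ^ 2) / 2
        - 576 * d * (αh ^ 2 * Real.exp (2 * αh))) / (Fintype.card n : ℝ) - 28 * d * (ε + 7 * αh ^ 2)))
    {𝒟 : Set (Site d → Fin d → (Matrix n n ℂ)ˣ)} {P : ℕ → (Site d → Fin d → (Matrix n n ℂ)ˣ) → (Site d → Fin d → (Matrix n n ℂ)ˣ) → Prop}
    (hleaves : ∀ D ∈ 𝒟, ∀ (k : ℕ), ∀ Us ∈ admissible (sfClass d L N ε) L (k + 1) D, P k D Us →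
      ∀ U' ∈ admissible (sfClass d L N ε) L (k + 1) D,
      ∃ (u : Site d → (Matrix n n ℂ)ˣ) (X₀ : Site d → Fin d → Matrix n n ℂ) (α₀ : ℝ) (m : Site d → Fin d → ℝ) (C : ℝ),
        IsSkewDir X₀ ∧
        (∀ (hWu : IsUnitaryCfg Us) (hx : 0 ≤ ε / ((L : ℝ) ^ (k + 1)) ^ 2) (hs : LevelSmall d L k (ε / ((L : ℝ) ^ (k + 1)) ^ 2))
            (hWx : SmallField Us (ε / ((L : ℝ) ^ (k + 1)) ^ 2))
            (hθ : cruxC d L * (((L : ℝ) ^ (k + 1)) ^ 2 * (ε / ((L : ℝ) ^ (k + 1)) ^ 2)) < 1)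
            (hφ : IsSkewDir (dirIter L (k + 1) Us X₀)),
          ResidualSliceRepT L N (k + 1) Us U' u X₀ (rightInvW hL k hWu hx hs hWx N hθ hφ) α₀) ∧
        (∀ z κ, 0 ≤ m z κ) ∧ 0 ≤ C ∧
        ((L : ℝ) ^ (k + 1)) ^ d * ∑ z ∈ periodBox (d := d) N, ∑ κ : Fin d, m z κ ^ 2
          ≤ C ^ 2 * dirSq X₀ (periodBox (d := d) (N * L ^ (k + 1))) ∧
        (∀ z ∈ periodBox (d := d) N, ∀ κ : Fin d, ‖dirIter L (k + 1) Us X₀ z κ‖ ≤ C₂ * ((L : ℝ) ^ (k + 1) * m z κ) ^ 2) ∧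
        α₀ * (L : ℝ) ^ (k + 1) ≤ αh ∧ (∀ z κ, m z κ * (L : ℝ) ^ (k + 1) ≤ αh) ∧ C ≤ Ch) :
    ∀ D ∈ 𝒟, ∀ (k : ℕ), ∀ Us ∈ admissible (sfClass d L N ε) L (k + 1) D, P k D Us →
      ∀ U' ∈ admissible (sfClass d L N ε) L (k + 1) D, ∃ (u : Site d → (Matrix n n ℂ)ˣ) (X XT XN : Site d → Fin d → Matrix n n ℂ)
        (α ν κ₁ : ℝ), IsUnitarySite u ∧ IsSkewDir X ∧ IsPeriodicDir X ((N * L ^ (k + 1) : ℕ) : ℤ) ∧ 0 ≤ α ∧ (∀ x μ, ‖X x μ‖ ≤ α) ∧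
        gaugeAct u U' = vary Us X 1 ∧
        X = XT + XN ∧ XT ∈ frameFreeBlockLandauW (d := d) (n := n) L N (k + 1) Us ∧ IsSkewDir XN ∧ 0 ≤ ν ∧
        energyNormW L (k + 1) Us XN (periodBox (d := d) (N * L ^ (k + 1)))
          ≤ ν * energyNormW L (k + 1) Us X (periodBox (d := d) (N * L ^ (k + 1))) ∧
        ε / ((L : ℝ) ^ (k + 1)) ^ 2 * (∑ p ∈ perWin d (N * L ^ (k + 1)), ‖curl Us XN p‖)
          ≤ κ₁ * energyNormW L (k + 1) Us X (periodBox (d := d) (N * L ^ (k + 1))) ^ 2 ∧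
        2 * κ₁ < ((((1 / 2 - ν ^ 2) / (2 * (1 + CP)) - ν ^ 2) / 2
            - 576 * d * (Real.exp α - 1) ^ 2 * ((L : ℝ) ^ (k + 1)) ^ 2) / (Fintype.card n : ℝ)
            - 28 * d * (ε / ((L : ℝ) ^ (k + 1)) ^ 2 + 7 * α ^ 2) * ((L : ℝ) ^ (k + 1)) ^ 2) := by
  intro D hD k Us hUs hP U' hU'
  obtain ⟨u, X₀, α₀, m, C, hXs, hrep, hm0, hC, hsq, hφq, hαh, hmh, hCh⟩ := hleaves D hD k Us hUs hP U' hU'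
  exact repW_of_routePi hL k hε (hls k) hθl hε1 hC₂ hαh0 hαh1 hCh0 hνh hκh hν hline hUs.1 hXs hrep hm0 hC hsq hφq hαh hmh hCh

end

end Summit.QuantumFields.BalabanUV.T4Continuum.NE7RepWGaugeOfRoutePi
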